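import Summits.ValiantsHypothesis.ValiantsHypothesis.Theorems.LacunarySymmetroidMatrixDescartesCensusV20SoundRows

/-!
# `MatrixDescartes` census — soundness of the `V = 20` certificate checker: count vectors, factored rationals and the accumulated Farkas product

HONEST FRAMING.  Object-search cell `pub-symmetroid`; door-A item `DoorA26 = PosRootLawAt 2 6 19`
(stmt-ValiantsHypothesis-19979; OPEN, typed, never asserted).  Part of the proof that a certificate accepted by `V20.checkCell` (`…CensusV20Check`) excludes a twenty — `20 = D(2,6)` distinct
positive det-roots of a six-term real symmetric `2 × 2` pencil — on its support (semantics: `…CensusV20Model`).  Nothing here bears on `V = 19`, on `ζ_sym(2,6)` over all supports, on `DoorA26` itself, on `MatrixDescartes`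
(stmt-ValiantsHypothesis-18050) or on `VP ≠ VNP`.

[folklore] Certificate-checker soundness / replay; elementary.
-/

-- the D-0017 layout repeats a namespace component (single-conjunct summit); the `dupNamespace` linter flags it; name mandated.
set_option linter.dupNamespace false

namespace Summit.ValiantsHypothesis.ValiantsHypothesis.Theorems.LacunarySymmetroidMatrixDescartes.Census.V20

/-! ## Soundness, abstract layer (continued): exponent balance, constant comparison, the three certificate kinds -/

section Certs

open Finset

variable {dl : List ℕ} {ord : List Atom} {s : Bool} {x : ℕ → ℝ} {v : Atom → ℝ}

/-! ### Count vectors: `xpow x V = ∏_t x_t^{V_t}` -/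

/-- `xpowAux` is positive. [folklore] -/
theorem xpowAux_pos (hx : ∀ t, 0 < x t) : ∀ (V : List ℕ) (t : ℕ), 0 < xpowAux x V t
  | [], _ => by simp [xpowAux]
  | e :: V, t => by rw [xpowAux]; exact mul_pos (pow_pos (hx t) e) (xpowAux_pos hx V (t + 1))

/-- `xpowAux` of a zero vector is `1`. [folklore] -/
theorem xpowAux_replicate_zero (x : ℕ → ℝ) : ∀ (n t : ℕ), xpowAux x (List.replicate n 0) t = 1
  | 0, _ => by simp [xpowAux]
  | n + 1, t => by rw [List.replicate_succ, xpowAux, pow_zero, one_mul, xpowAux_replicate_zero x n (t + 1)]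

/-- `bump` keeps the length. [folklore] -/
theorem length_bump : ∀ (V : List ℕ) (p n : ℕ), (bump V p n).length = V.length
  | [], _, _ => rfl
  | _ :: _, 0, _ => rfl
  | e :: V, p + 1, n => by simp [bump, length_bump V p n]

/-- `bump` multiplies `xpowAux` by a power. [folklore] -/
theorem xpowAux_bump (x : ℕ → ℝ) : ∀ (V : List ℕ) (p n t : ℕ), p < V.length →
    xpowAux x (bump V p n) t = xpowAux x V t * x (t + p) ^ n
  | [], p, n, t, h => by simp at h
  | e :: V, 0, n, t, _ => by simp only [bump, xpowAux, pow_add, add_zero]; ring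
  | e :: V, p + 1, n, t, h => by
    simp only [bump, xpowAux]
    rw [xpowAux_bump x V p n (t + 1) (by simpa using h), show t + 1 + p = t + (p + 1) by ring]
    ring

/-- `bumps` keeps the length. [folklore] -/
theorem length_bumps (V : List ℕ) (ps : List ℕ) (n : ℕ) : (bumps V ps n).length = V.length := by
  unfold bumps
  induction ps generalizing V with
  | nil => rfl
  | cons p ps ih => rw [List.foldl_cons, ih, length_bump]

/-- `bumps` multiplies `xpow` by a power of `lprod`. [folklore] -/
theorem xpow_bumps (x : ℕ → ℝ) (V : List ℕ) (ps : List ℕ) (n : ℕ) (hps : ∀ p ∈ ps, p < V.length) :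
    xpow x (bumps V ps n) = xpow x V * lprod x ps ^ n := by
  unfold bumps
  induction ps generalizing V with
  | nil => simp [lprod]
  | cons p ps ih =>
    rw [List.foldl_cons, ih (bump V p n) (fun q hq => by rw [length_bump]; exact hps q (by simp [hq])),
      xpow, xpowAux_bump x V p n 0 (hps p (by simp)), zero_add, lprod_cons, mul_pow, ← xpow]
    ring

/-! ### Factored rationals -/

/-- `frval []`. [folklore] -/
theorem frval_nil : frval [] = 1 := by simp [frval]

/-- `frval` of a cons. [folklore] -/
theorem frval_cons (b : ℕ) (z : ℤ) (A : FRat) : frval ((b, z) :: A) = (b : ℝ) ^ z * frval A := by simp [frval]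

/-- `insZ` multiplies the value. [folklore] -/
theorem frval_insZ {A : FRat} {b : ℕ} (hb : 0 < b) (z : ℤ) : frval (insZ A b z) = frval A * (b : ℝ) ^ z := by
  induction A with
  | nil => simp [insZ, frval]
  | cons bz A ih =>
    obtain ⟨b', z'⟩ := bz
    unfold insZ
    split_ifs with h
    · subst h
      rw [frval_cons, frval_cons, zpow_add₀ (by exact_mod_cast hb.ne' : (b' : ℝ) ≠ 0)]
      ring
    · rw [frval_cons, frval_cons, ih]; ring

/-- `insZ` keeps bases positive. [folklore] -/
theorem bpos_insZ {A : FRat} (hA : BPos A) {b : ℕ} (hb : 0 < b) (z : ℤ) : BPos (insZ A b z) := by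
  induction A with
  | nil => intro bz hbz; simp [insZ] at hbz; subst hbz; exact hb
  | cons bz A ih =>
    obtain ⟨b', z'⟩ := bz
    unfold insZ
    split_ifs with h
    · intro c hc
      simp only [List.mem_cons] at hc
      rcases hc with rfl | hc
      · exact hb
      · exact hA c (by simp [hc])
    · intro c hc
      simp only [List.mem_cons] at hc
      rcases hc with rfl | hc
      · exact hA (b', z') (by simp)
      · exact ih (fun d hd => hA d (by simp [hd])) c hc

/-- `mulF` multiplies the value by `fval ^ n`. [folklore] -/
theorem frval_mulF {A : FRat} {F : FNat} (hF : ∀ be ∈ F, 0 < be.1) (n : ℕ) (hA : BPos A) :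
    frval (mulF A F n) = frval A * (fval F : ℝ) ^ n ∧ BPos (mulF A F n) := by
  unfold mulF
  induction F generalizing A with
  | nil => simp [fval]; exact hA
  | cons be F ih =>
    obtain ⟨b, e⟩ := be
    have hb : 0 < b := hF (b, e) (by simp)
    rw [List.foldl_cons]
    obtain ⟨h1, h2⟩ := ih (A := insZ A b ((e * n : ℕ) : ℤ)) (fun c hc => hF c (by simp [hc])) (bpos_insZ hA hb _)
    refine ⟨?_, h2⟩
    rw [h1, frval_insZ hb, fval_cons, zpow_natCast]
    push_cast
    ring

/-- `divF` divides the value by `fval ^ n`. [folklore] -/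
theorem frval_divF {A : FRat} {F : FNat} (hF : ∀ be ∈ F, 0 < be.1) (n : ℕ) (hA : BPos A) :
    frval (divF A F n) = frval A / (fval F : ℝ) ^ n ∧ BPos (divF A F n) := by
  unfold divF
  induction F generalizing A with
  | nil => simp [fval]; exact hA
  | cons be F ih =>
    obtain ⟨b, e⟩ := be
    have hb : 0 < b := hF (b, e) (by simp)
    have hb' : (b : ℝ) ≠ 0 := by exact_mod_cast hb.ne'
    rw [List.foldl_cons]
    obtain ⟨h1, h2⟩ := ih (A := insZ A b (-((e * n : ℕ) : ℤ))) (fun c hc => hF c (by simp [hc])) (bpos_insZ hA hb _)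
    refine ⟨?_, h2⟩
    rw [h1, frval_insZ hb, fval_cons, zpow_neg, zpow_natCast]
    push_cast
    rw [mul_pow, ← pow_mul, ← div_eq_mul_inv, div_div]

/-- After cancellation: `frval A = numZ A / denZ A`. [folklore] -/
theorem frval_eq_numZ_div_denZ {A : FRat} (hA : BPos A) :
    frval A = (numZ A : ℝ) / (denZ A : ℝ) ∧ 0 < denZ A := by
  induction A with
  | nil => simp [frval, numZ, denZ]
  | cons bz A ih =>
    obtain ⟨b, z⟩ := bz
    have hb : 0 < b := hA (b, z) (by simp)
    obtain ⟨h1, h2⟩ := ih (fun c hc => hA c (by simp [hc]))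
    have hnum : numZ ((b, z) :: A) = (if 0 < z then b ^ z.toNat else 1) * numZ A := by simp [numZ]
    have hden : denZ ((b, z) :: A) = (if z < 0 then b ^ (-z).toNat else 1) * denZ A := by simp [denZ]
    rw [frval_cons, h1, hnum, hden]
    refine ⟨?_, Nat.mul_pos (by split_ifs <;> positivity) h2⟩
    have hbR : (0 : ℝ) < b := by exact_mod_cast hb
    rcases lt_trichotomy z 0 with hz | rfl | hz
    · rw [if_neg (by omega), if_pos hz]
      have : (b : ℝ) ^ z = 1 / (b : ℝ) ^ (-z).toNat := by
        rw [← zpow_natCast, Int.toNat_of_nonneg (by omega), zpow_neg, one_div, inv_inv]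
      rw [this]; push_cast
      field_simp
    · simp
    · rw [if_pos hz, if_neg (by omega)]
      have : (b : ℝ) ^ z = (b : ℝ) ^ z.toNat := by
        rw [← zpow_natCast, Int.toNat_of_nonneg hz.le]
      rw [this]; push_cast
      field_simp

/-! ### The accumulated Farkas product -/

/-- Semantics of `accumulate`: the count vectors carry the monomials, the factored rational carries the
constants, and the rows multiply up. [folklore] -/
theorem accumulate_spec (hx : ∀ t, 0 < x t) (rs : List (Row × ℕ))
    (hrs : ∀ rn ∈ rs, Row.Holds x rn.1 ∧ rn.1.WF) :
    ∀ (acc : List ℕ × List ℕ × FRat), acc.1.length = 21 → acc.2.1.length = 21 → BPos acc.2.2 →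
      let res := rs.foldl (fun acc rn =>
        (bumps acc.1 rn.1.L rn.2, bumps acc.2.1 rn.1.R rn.2, divF (mulF acc.2.2 rn.1.Bden rn.2) rn.1.Bnum rn.2)) acc
      res.1.length = 21 ∧ res.2.1.length = 21 ∧ BPos res.2.2 ∧
        ∃ PL PR Cd Cn : ℝ, 0 < PL ∧ 0 < Cn ∧ 0 < Cd ∧
          xpow x res.1 = xpow x acc.1 * PL ∧ xpow x res.2.1 = xpow x acc.2.1 * PR ∧
          frval res.2.2 = frval acc.2.2 * (Cd / Cn) ∧ PL * Cd ≤ PR * Cn := by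
  induction rs with
  | nil =>
    intro acc h1 h2 h3
    exact ⟨h1, h2, h3, 1, 1, 1, 1, one_pos, one_pos, one_pos, by simp, by simp, by simp, le_rfl⟩
  | cons rn rs ih =>
    intro acc h1 h2 h3
    obtain ⟨⟨hold, hL, hR, hBn, hBd⟩, hrest⟩ :
        (Row.Holds x rn.1 ∧ rn.1.WF) ∧ ∀ rn' ∈ rs, Row.Holds x rn'.1 ∧ rn'.1.WF :=
      ⟨hrs rn (by simp), fun rn' h => hrs rn' (by simp [h])⟩
    rw [List.foldl_cons]
    set acc' : List ℕ × List ℕ × FRat :=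
      (bumps acc.1 rn.1.L rn.2, bumps acc.2.1 rn.1.R rn.2, divF (mulF acc.2.2 rn.1.Bden rn.2) rn.1.Bnum rn.2) with hacc'
    have hm := frval_mulF hBd rn.2 h3
    have hd := frval_divF hBn rn.2 hm.2
    have h1' : acc'.1.length = 21 := by rw [hacc']; simp only; rw [length_bumps]; exact h1
    have h2' : acc'.2.1.length = 21 := by rw [hacc']; simp only; rw [length_bumps]; exact h2
    obtain ⟨r1, r2, r3, PL, PR, Cd, Cn, hPL, hCn, hCd, e1, e2, e3, hle⟩ := ih hrest acc' h1' h2' hd.2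
    refine ⟨r1, r2, r3, lprod x rn.1.L ^ rn.2 * PL, lprod x rn.1.R ^ rn.2 * PR,
      (fval rn.1.Bden : ℝ) ^ rn.2 * Cd, (fval rn.1.Bnum : ℝ) ^ rn.2 * Cn, ?_, ?_, ?_, ?_, ?_, ?_, ?_⟩
    · exact mul_pos (pow_pos (lprod_pos hx _) _) hPL
    · exact mul_pos (pow_pos (by exact_mod_cast fval_pos hBn) _) hCn
    · exact mul_pos (pow_pos (by exact_mod_cast fval_pos hBd) _) hCd
    · rw [e1, hacc']; simp only
      rw [xpow_bumps x _ _ _ (fun p hp => by rw [h1]; exact hL p hp)]; ring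
    · rw [e2, hacc']; simp only
      rw [xpow_bumps x _ _ _ (fun p hp => by rw [h2]; exact hR p hp)]; ring
    · rw [e3, hacc']; simp only
      rw [hd.1, hm.1]
      have : (fval rn.1.Bnum : ℝ) ^ rn.2 ≠ 0 := pow_ne_zero _ (by exact_mod_cast (fval_pos hBn).ne')
      field_simp
    · have hrow : lprod x rn.1.L ^ rn.2 * (fval rn.1.Bden : ℝ) ^ rn.2 ≤ lprod x rn.1.R ^ rn.2 * (fval rn.1.Bnum : ℝ) ^ rn.2 := by
        rw [← mul_pow, ← mul_pow]
        exact pow_le_pow_left₀ (mul_nonneg (lprod_pos hx _).le (by positivity)) hold _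
      calc lprod x rn.1.L ^ rn.2 * PL * ((fval rn.1.Bden : ℝ) ^ rn.2 * Cd)
          = (lprod x rn.1.L ^ rn.2 * (fval rn.1.Bden : ℝ) ^ rn.2) * (PL * Cd) := by ring
        _ ≤ (lprod x rn.1.R ^ rn.2 * (fval rn.1.Bnum : ℝ) ^ rn.2) * (PR * Cn) :=
          mul_le_mul hrow hle (mul_nonneg hPL.le hCd.le)
            (mul_nonneg (pow_nonneg (lprod_pos hx _).le _) (by positivity))
        _ = lprod x rn.1.R ^ rn.2 * PR * ((fval rn.1.Bnum : ℝ) ^ rn.2 * Cn) := by ring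

/-- `accumulate` unfolded. [folklore] -/
theorem accumulate_eq_foldl (rs : List (Row × ℕ)) :
    accumulate rs = rs.foldl (fun acc rn =>
      (bumps acc.1 rn.1.L rn.2, bumps acc.2.1 rn.1.R rn.2, divF (mulF acc.2.2 rn.1.Bden rn.2) rn.1.Bnum rn.2))
      (zero21, zero21, []) := rfl

/-- All built rows hold and are well formed. [folklore] -/
theorem buildRows_sound (M : Model dl ord s x v) :
    ∀ (specs : List (RowSpec × ℕ)) (rs : List (Row × ℕ)), buildRows dl ord s specs = some rs →
      ∀ rn ∈ rs, Row.Holds x rn.1 ∧ rn.1.WF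
  | [], rs, h => by simp [buildRows] at h; subst h; simp
  | (sp, n) :: specs, rs, h => by
    simp only [buildRows] at h
    split at h
    · next r rr hr hrr =>
      cases h
      intro rn hrn
      simp only [List.mem_cons] at hrn
      rcases hrn with rfl | hrn
      · exact buildRow_sound M hr
      · exact buildRows_sound M specs rr hrr rn hrn
    · cases h

/-- The Farkas product of accepted rows: monomial parts and the constant ratio. [folklore] -/
theorem accumulate_sound (M : Model dl ord s x v) {specs : List (RowSpec × ℕ)} {rs : List (Row × ℕ)}
    (h : buildRows dl ord s specs = some rs) :
    (accumulate rs).1.length = 21 ∧ (accumulate rs).2.1.length = 21 ∧ BPos (accumulate rs).2.2 ∧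
      ∃ PL PR Cd Cn : ℝ, 0 < PL ∧ 0 < Cn ∧ 0 < Cd ∧
        xpow x (accumulate rs).1 = PL ∧ xpow x (accumulate rs).2.1 = PR ∧
        frval (accumulate rs).2.2 = Cd / Cn ∧ PL * Cd ≤ PR * Cn := by
  have := accumulate_spec M.xpos rs (buildRows_sound M specs rs h) (zero21, zero21, [])
    (by simp [zero21]) (by simp [zero21]) (by intro bz h; simp at h)
  rw [accumulate_eq_foldl]
  obtain ⟨r1, r2, r3, PL, PR, Cd, Cn, hPL, hCn, hCd, e1, e2, e3, hle⟩ := this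
  refine ⟨r1, r2, r3, PL, PR, Cd, Cn, hPL, hCn, hCd, ?_, ?_, ?_, hle⟩
  · rw [e1, show xpow x (zero21, zero21, ([] : FRat)).1 = 1 from xpowAux_replicate_zero x 21 0, one_mul]
  · rw [e2, show xpow x (zero21, zero21, ([] : FRat)).2.1 = 1 from xpowAux_replicate_zero x 21 0, one_mul]
  · rw [e3, show frval (zero21, zero21, ([] : FRat)).2.2 = 1 from frval_nil, one_mul]

end Certs

end Summit.ValiantsHypothesis.ValiantsHypothesis.Theorems.LacunarySymmetroidMatrixDescartes.Census.V20
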